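import Summits.AtomisticToContinuum.HydrodynamicLimit.Theses.InformationPercolationEngine
import Summits.AtomisticToContinuum.HydrodynamicLimit.Theorems.InformationPercolationEnginePercolationClosesChaosForecastTransferW
import Summits.AtomisticToContinuum.HydrodynamicLimit.Theorems.InformationPercolationEnginePercolationClosesChaosCesaroLocalEquilibriumW
import Summits.AtomisticToContinuum.HydrodynamicLimit.Theorems.InformationPercolationEnginePercolationClosesChaosAtomCollisionDictionary
import Summits.AtomisticToContinuum.HydrodynamicLimit.Theorems.InformationPercolationEnginePercolationClosesChaosDockingR
import Summits.AtomisticToContinuum.HydrodynamicLimit.Theorems.InformationPercolationEnginePercolationClosesChaosOfInputs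

/-!
# Line `equilibrium-forecast-chain-rule` for crux `InformationPercolationEngine.PercolationClosesChaos` — skeleton v10
(item stmt-AtomisticToContinuum-15178, rev 12: `KickFairRelEquilibriumMeso → SpectralContractionR → ContactChaos`;
crux-plan round 2; idea card `Cruxes/PercolationClosesChaos/Ideas/equilibrium-forecast-chain-rule.md` (ideator 5);
line card `Lines/equilibrium-forecast-chain-rule.md`; stored as `Lines/equilibrium_forecast_chain_rule.lean`)

## v10 (lead c5, line cycle 6, 2026-08-17): TERMINAL FORM. Signatures of the five open stubs UNCHANGED (S2 `stub_mceW` crux-class;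
S3/S4/S4b/S8a item-class); S5 `stub_cesaroW` and S6 `stub_forecastTransferW` are the tree theorems of the same name (p155628, p157027 —
lead c4's v9.1, whose re-publish to this path was refused by a transient farm incoherence, is hereby published); the composition of §7 is
LANDED as sorry-free tree theorems `Theorems.EquilibriumForecastLine.percolationClosesChaos_of_inputs :
MesoForecastChaosB → MesoStaticMaxwellRarityW → LocalCountUI → NoKineticIrregularityB → NoMesoscopicOscillationR → RoughCollisionRare →
PercolationClosesChaos` and `…_of_coarseLocalMaxwellianityW` (file `…PercolationClosesChaosOfInputs.lean`, p158913 ACCEPTED; §7 `PercolationClosesChaos_of'`): once the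
planner files the six statements and they acquire `_holds` witnesses, the crux closes by one line. Nothing provable is left inside the line
(fourth consecutive `promote-stub`, leads a2/c3/c4/c5): S2 is the every-rate large-deviation H-theorem for the equilibrium `N`-body
hard-sphere dynamics (open-problem class, same class as the crux's physical content), S3/S4/S4b/S8a are a-priori statements about the EVOLVED
law (hydrodynamic-limit class; out of reach of the entropy method, which transfers only EVERY-RATE `G_N`-rarity — lead c5 note in
`Lines/equilibrium-forecast-chain-rule-lead-report-c5.md`).

## v9 (lead c4, line cycle 5, 2026-08-17): the ROBUST RESHAPE. S2.2 `MesoStaticMaxwellRarity` (log-marginal, v8 verdict below) is REPLACED by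
the collision-WEIGHTED, strictly weaker `MesoStaticMaxwellRarityW`, and S2.1 by `MesoForecastChaosB` (binned good-unit guard, `∃ b₀ ∀ b ≤ b₀`);
the transfer is re-plumbed through a REVEALED non-good indicator `Jng` (vocabulary `…ForecastRobustDefs`, p154257: `GoodUnitB`, `Jng`,
`JngSpec`, `CoarseLocalMaxwellianityW`, `NoKineticIrregularityB`, `BadForecastRareB`, `NonGoodRareW`, `ForecastSplitW`). SEVEN registered
stubs: S2 `stub_mceW` (crux-class, lead), S3 `stub_localCountUI`, S4 `stub_noMesoscopicOscillationR`, S4b `stub_noKineticIrregularityB`, S8a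
`stub_roughCollisionRare` (item-class), and the two PROVABLE compositions S5 `stub_cesaroW` (weighted static Cesàro assembly) and S6
`stub_forecastTransferW` (= `kineticCellChaosLG_of_w` with H1, H2_B, H3_W, H4, H5, H5_W). Why: the weighted statements are exactly what the
transfer consumes (collision-free non-Maxwellian cells own no collision and never mattered), their cheapest `G_N`-violations are
thermalising (rate `∝ N^{1/3}`, robust) instead of collision-free (rate `∝ log N`), and `MesoStaticMaxwellRarityW` isolates the large-deviation
H-theorem content with nothing else.

## v8 (lead c4, line cycle 5, 2026-08-17): NO signature change (stubs, composition and sha of the Lean content of §6–§7 as in v7;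
re-registered under lead c4). What v8 adds is a VERDICT on S2.2, recorded in the S2 docstring below and in
`Lines/equilibrium-forecast-chain-rule-lead-report-c4.md`: `MesoStaticMaxwellRarity` is TRUE ONLY BY A `log N` MARGIN — its cheapest
violation under `G_N` is a COLLISION-FREE structure (a dilute slab of volume `f` filled with two rigid counter-streaming sheet lattices
`±u x̂`, sheets of width `h/4` parallel to the motion, `m₁ ≥ m₀` spheres per cell: every core cell is Regular, populated and `≈ 2.6`-nat
non-Maxwellian for the whole horizon), of `G_N`-cost `(N+1)[log(1/(1−f)) + f (m₁/n̄)(3 log(1/α) + O(1))]` with rigidity precision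
`α ≍ h m₁^{-1/3}/τ ∝ N^{-1/3}`, i.e. rate `≈ f + f (m₁/n̄) log N → ∞` only logarithmically (all thermalising mechanisms cost `∝ K_N ∝ N^{1/3}`).
So the statement stands (asymptotic, `N₀(L) ≳ exp(L n̄/(f m₁))`), but any proof must be sharp at the scale of the velocity-alignment
entropy of collision-free sub-populations: (i) persistently flagged populated cells ⇒ an essentially collision-free sub-population
(the `N`-body large-deviation H-theorem — the open core) and (ii) collision-free coexistence over a macroscopic time ⇒ alignment to
`N^{-1/3}` ⇒ `≥ log N` nats per sphere (geometric, plausible lemma-class). Outcome unchanged: `promote-stub` (S2), S3/S4/S4b/S8a to file.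

Skeleton (v9, superseded by v10 above): SEVEN registered `sorry`-stubs — S2 `stub_mceW` (crux-class, lead), S3 `stub_localCountUI`, S4 `stub_noMesoscopicOscillationR`,
S4b `stub_noKineticIrregularityB`, S8a `stub_roughCollisionRare` (item-class LG-side inputs to be FILED by the planner), S5 `stub_cesaroW`, S6
`stub_forecastTransferW` (PROVABLE, cycle-5 wave) —, the CLOSED stubs S7 `stub_dockingR`, S8b `stub_atomCollisionDictionary`, S8
`stub_revealedDefectStability` (tree theorems / compositions) and the kernel-checked composition `PercolationClosesChaos_of : PercolationClosesChaos`
(no `sorry` of its own). v8 state for comparison: the crux was kernel-reduced to `MesoForecastChaos ∧ MesoStaticMaxwellRarity` plus four LG-side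
items with nothing provable left; v9 trades the log-marginal `MesoStaticMaxwellRarity` for the weaker, robust `MesoStaticMaxwellRarityW` at the
price of re-proving S5/S6 in weighted form.

## v7 (lead c3, line cycle 4, wave-3 integrated, 2026-08-17): S8b `stub_atomCollisionDictionary` CLOSED (`…AtomCollisionDictionary` p149815, worker W8,
392 lines: `jumps` as a mapped window-index list, `atomTransfer`, the bijection `atomMap`); planner dossier `Lines/equilibrium-forecast-chain-rule-ITEMS.md`. The line docks through the CONCLUSION (`fun _ _ => …`, Disproof §1
`crux_of_contactChaos` / F16): neither `KickFairRelEquilibriumMeso` nor the PROVED `SpectralContractionR` is consumed.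

## v6 (lead c3, line cycle 4, wave-2 integrated, 2026-08-17) — what changed and why

* CLOSED by wave-2 (all `--supports` 15178, namespace `Theorems.EquilibriumForecastLine`): S5 `stub_cesaroLocalEquilibrium` (`…CesaroLocalEquilibrium`
  p144149; floor assembly `…CesaroStaticAssemblyFloor` p142485, worker W4); S6 `stub_forecastTransfer` (`…ForecastTransfer`, lead, = `kineticCellChaosLG_of`
  with H1 `forecastSwap_holds` p141614, H2 `badForecastRare_of_forecastChaos` p143786, H3 `nonGoodRare_of` p143544 (W1), H4 `revealedSandwich_of` p144080 +
  dictionary `ownedCount_eq_of_seqHistLE_eq` p142647 (W3), H5 `forecastAlgebra_holds` p144106 + `…ForecastAlgebraMeans` p142921 (W2)); S7 `stub_dockingR`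
  (`…DockingR` p143824, W7). Red-team audit of the four re-typed statements: all STAND (W5, `…ForecastRetypedProbes` p142989, attack log in the lead
  report); one docstring heuristic corrected (see S2 below).
* S8 RESHAPED after W6's audit (`RevealedDefectStability` CLEAN and ITEM-CLASS as typed; reduction landed: `…RevealedDefectFacts` p142789,
  `…RevealedDefectReduction` p143339, `…RevealedDefectFluxStability` p144032, `…RevealedDefectPairLaw` p144766, `…RevealedDefectDictionaryBound` p146005,
  `…RevealedDefectAssembly` p146207): `RevealedDefectStability ⇐ RoughCollisionRare ∧ AtomCollisionDictionary`
  (`revealedDefectStability_of_atomCollisionDictionary`), with `RoughCollisionRare` the MINIMAL LG-side input (rough = grazing ∨ fast ∨ untame owned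
  collisions are rare in truncated unit weight) and `AtomCollisionDictionary` a deterministic enumeration statement (two good points of one revealed
  atom have label-preserving, bin-close corresponding owned collision triples). So S8 := S8a `stub_roughCollisionRare` (item) + S8b
  `stub_atomCollisionDictionary` (provable; wave-3).

## v5 (lead c3, line cycle 4, 2026-08-17) — what changed and why (RESHAPE after wave-1 of cycle 4)

* LANDED in cycle 4 (all `--supports` 15178, namespace `Theorems.EquilibriumForecastLine`): the docking S7 end to end (`…DockingDisplacement`
  p134344, `…DockingBudgetOrder` p134451, `…DockingTail` p134640, `…DockingDeterministic` p135004, `…DockingAssembly` p135282,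
  `…DockingMeasurable` p135792, `…Docking` p136041); the Cesàro pieces of S5 (`…CesaroTransfer` p136396 — the `G_N → LG` entropy-inequality
  transfer `exists_lgTransferConst`; `…CesaroTelescoping` p136640, `…CesaroKdeStability` p137089, `…CesaroNbhdSupport` p137294,
  `…CesaroMeasurable` p137631, `…CesaroTransferLintegral` p137741, `…CesaroStaticAssembly` p138169); the backbone of S6 (`…ForecastObsMeasurable`
  p139095, `…ForecastEnumeration` p139258, `…ForecastReveal` p139930, `…ForecastFiltration` p140212 — the sequential filtration as a `pastSigma`
  with EXACT σ-algebra identities —, `…ForecastTransferArch` p140186 — the architecture `kineticCellChaosLG_of : ForecastSwap → BadForecastRare →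
  NonGoodRare → RevealedSandwich → ForecastAlgebra → KineticCellChaosLG` —, `…ForecastSwap` p141614 — H1 `forecastSwap_holds` PROVED: the
  predictable projection APPLIED under `LG` against `G_N`); the re-typed statements `…ForecastRetyped` p141357.
* RE-TYPED (three findings, all recorded in the docstrings of `…ForecastRetyped.lean`):
  (α, worker S5) conjunct (b) of `MesoConditionalEquidistribution` v2 let the H-theorem gain `κ` degenerate with the tolerances (`∀ δ' L → ∃ κ`);
  (β, lead c3) independently, (b) and its static repair (b″) are FALSE at every large rate `L`: `Regular` has no occupancy floor, and in a
  low-density macrostate of `G_N`-cost `e^{-O(N)}` a positive stationary fraction of cells are isolated pairs — `Regular` (`inhom = 0`) and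
  `ϑ`-non-Maxwellian with probability `O(1)` at equilibrium, at every time (`stub_mce-b-kill.md` in the crux dir); the repaired
  `MesoStaticMaxwellRarity` counts cells holding `≥ m₀` spheres, `∃ m₀` after `(ϑs, ϑ, δ', L)`;
  (γ, worker S5) conjunct (ii) of `NoMesoscopicOscillation` v2 was VACUOUS (its summand is `1` on infinitely many non-cells of `ℤ³`, the `tsum`
  inside `unitAvg` is junk `0`); re-typed as `NoKineticIrregularity` (actual-cell guard; also absorbs kinetic rarefaction `0 < #pop < m₀`), while
  conjunct (i) — the only part the docking used — became the stand-alone `NoMesoscopicOscillationR` (docking re-landed as `stub_dockingR`).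
* S2 is now `MesoForecastChaos ∧ MesoStaticMaxwellRarity` (conjunct (a) of v2 VERBATIM ∧ the repaired static statement); S5 is the STATIC Cesàro
  assembly (Option C of the S5 audit: no predictable projection, no conditional H-theorem, no bin reconstruction; closed end to end in scratch over
  (b″), one assembly lemma to re-prove with the floor); S6 = the architecture with H1 and H2 (`badForecastRare_of_forecastChaos`) PROVED, H3/H4/H5
  waved; S1 `PredictableProjection` is a tree theorem (`predictableProjection_holds`) consumed inside H1 and no longer a stub.

## v2–v4 recap

* v2 (lead a2): S1 CLOSED (p124443); S2 v1 (atomwise) REFUTED (kill record `Lines/…stub_mce-kill.md`), v2 = large-deviation form; audits folded in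
  (`seqHistEnd`, `seqHistLE`, `defectOsc`, S8 `RevealedDefectStability`, NMO (i) with `r₀` before `c₀`, UI (i) on row counts).
* v3 (lead c2): vocabulary moved to the tree (`…ForecastDefs` p125723, `…ForecastStatements` p126046); docking pieces A/B/C/E/F0.
* v4 (lead c3): docking pieces F1/F0'/tail/F2/G/M and `stub_docking` CLOSED; wave on S5/S6/S7-M/S8.

## The line in one paragraph

Spend the entropy budget `H(LG | G_N) ≤ K(N+1)` through the Kullback–Leibler CHAIN RULE along a nested MESOSCOPIC filtration of the deterministic
flow (cells `Torus.coarseCell (c ℓ_N)`, steps `Δ_N = c ℓ_N`, per-sphere ORDERED lists of reduced collision records of a step — no collision time —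
revealed SEQUENTIALLY over cells in lexicographic order inside a step, each collision OWNED by the lex-smaller of the two start cells).
`PredictableProjection` (PROVED) says the `LG`-forecast of the next revealed increment given the past equals its `G_N`-forecast up to an `L¹(LG)`
remainder `C √(2 K'·KL)` (APPLIED: `forecastSwap_holds`); kinetic-cell chaos under the EVOLVED law reduces to `MesoForecastChaos` (large-deviation
rarity, under the INVARIANT law, of good units with a bad forecast — crux-class) plus LG-side inputs (S3 `LocalCountUI`, S4b `NoKineticIrregularity`,
S8 `RevealedDefectStability`), the derived local equilibrium S5 (from `MesoStaticMaxwellRarity`), the engine application S6 (`KineticCellChaosLG`)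
and the kinetic docking S7 into `ContactChaos` with S4 `NoMesoscopicOscillationR` (typed against the target's own `Pm`).

## Registered stubs (v10 = v9.1; five `sorry`s)

* S2 `stub_mceW : MesoForecastChaosB ∧ MesoStaticMaxwellRarityW` — HARDEST (crux-class, OPEN; lead). Promote as TWO items (weighted static first).
* S3 `stub_localCountUI`, S4 `stub_noMesoscopicOscillationR`, S8a `stub_roughCollisionRare` — item-class, as in v7/v8/v9.
* S4b `stub_noKineticIrregularityB : NoKineticIrregularityB` — item-class (binned twin of v5's statement).
* Closed: S5 `stub_cesaroW` (p155628), S6 `stub_forecastTransferW` (p157027), S7 `stub_dockingR` (p143824), S8b `stub_atomCollisionDictionary`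
  (p149815), S8 mod S8a (p146207); the composition itself is the tree theorem `percolationClosesChaos_of_inputs` (`…OfInputs.lean`, lead c5).

Composition (sorry-free): `PercolationClosesChaos_of := fun _ _ => stub_dockingR (stub_forecastTransferW S2.1 S3 S4b (stub_cesaroW S2.2 S3 S4b) S8) S4 S3`
(= `percolationClosesChaos_of_inputs S2.1 S2.2 S3 S4b S4 S8a`).

## Registered stubs (v7, superseded)

* S2 `stub_mce : MesoForecastChaos ∧ MesoStaticMaxwellRarity` — HARDEST (crux-class, OPEN; lead). Promote as TWO items.
* S3 `stub_localCountUI : LocalCountUI` — item-class LG-side tail input (to be filed).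
* S4 `stub_noMesoscopicOscillationR : NoMesoscopicOscillationR` — item-class, the shared `[cℓ_N, r]` residual / kill criterion (iv) (to be filed).
* S4b `stub_noKineticIrregularity : NoKineticIrregularity` — item-class LG-side regularity input (to be filed).
* S8a `stub_roughCollisionRare : RoughCollisionRare` — item-class LG-side tail input (to be filed; replaces `RevealedDefectStability` as the item).
* S5 `stub_cesaroLocalEquilibrium` — CLOSED (p144149). S6 `stub_forecastTransfer` — CLOSED (`…ForecastTransfer` p147963). S7 `stub_dockingR` — CLOSED (p143824).
  S8b `stub_atomCollisionDictionary` — CLOSED (p149815). S8 `stub_revealedDefectStability := revealedDefectStability_of_atomCollisionDictionary S8a S8b` —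
  closed modulo the item S8a.

Composition (sorry-free): `PercolationClosesChaos_of := fun _ _ => stub_dockingR (stub_forecastTransfer S2.1 S3 S4b (stub_cesaroLocalEquilibrium
S2.2 S3 S4b) S8) S4 S3`.

Disproof used (Cruxes/PercolationClosesChaos/Disproof.lean cycle 5, F1–F21, re-read 2026-08-17 by c3; unchanged since 2026-08-16T14:55Z):
§1 `crux_of_contactChaos`, `withoutKick_iff_target`, `not_withoutKick_iff` (no `_false_without_` theorem for this dock, F16); F8 D1/D3; F17;
F18 d(ii) ⇒ S3 named; F18 e / `docking_reference_gap` ⇒ S4 typed against the target's `Pm`; F20/F21 (no energy-weighted collision functional is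
used); F10 b = S4's kill criterion. No `-- Targets` section for this line's stubs yet.
-/

noncomputable section

open MeasureTheory Set Filter Topology
open scoped ENNReal BigOperators Classical
open Literature.Analysis.FluidPDE Literature.MathematicalPhysics.KineticTheory
open Literature.MathematicalPhysics.KineticTheory.VelocityBlindPlacement
open Summit.AtomisticToContinuum.HydrodynamicLimit.Theses.InformationPercolationEngine
open Summit.AtomisticToContinuum.HydrodynamicLimit.Theorems.EquilibriumForecastLine

namespace Summit.AtomisticToContinuum.HydrodynamicLimit.Cruxes.PercolationClosesChaos.EquilibriumForecastChainRule

/-! ## §6 The registered stubs -/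

/-- **Stub S2 (v9) — the two ROBUST large-deviation statements about the INVARIANT law** (`MesoForecastChaosB ∧ MesoStaticMaxwellRarityW`;
HARDEST; crux-class, XL; `G_N` only; lead). `MesoForecastChaosB` = `MesoForecastChaos` (conjunct (a) of v2, red team W5 clean) with the BINNED
good-unit guard `GoodUnitB b` and `∃ b₀ ∀ b ≤ b₀` after `c`: good weighty units have a bad `G_N`-forecast of their one-step collision statistics
only on a space-time density of units that is large-deviation rare at EVERY rate `L(N+1)` once `c ≥ c₀(L)` (cheapest violation renewal-type,
rate `∝ K_N ∝ N^{1/3}`). `MesoStaticMaxwellRarityW` = the COLLISION-WEIGHTED static Maxwell rarity: the unit average of `𝟙{Regular (binned),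
≥ m₀ spheres, ϑ-non-Maxwellian (binned)} · min(ownedCount, T)` exceeds `δ'` only LD-rarely at every rate under `G_N`. It replaces v5's
`MesoStaticMaxwellRarity`, which lead c4 showed to be TRUE ONLY BY A `log N` MARGIN (cheapest violation COLLISION-FREE: rigid counter-streaming
sheet lattices in a dilute slab, rate `≈ f + f(m₁/n̄) log N`; `Lines/…-lead-report-c4.md`); the weighted statement gives such structures weight
`0`, so its cheapest violation must keep non-Maxwellian populated cells COLLIDING for `K_N` steps (renewal or per-collision fine-tuning against
the `ℓ/ε`-hyperbolicity): rate `∝ N^{1/3}`, robust — and it is exactly the LARGE-DEVIATION H-THEOREM content (collisions ⇒ Maxwellisation) for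
the equilibrium hard-sphere dynamics at the kinetic scale, the one unprinted dynamical input for `N ≥ 3` hard balls. Strictly weaker than the
v5 statement read on binned velocities (`weighted_le_T_mul`). Earlier kills (do not re-type towards them): v1 atomwise (a2), v2 (b) / (b″)
floor-less (c3). Handed back as `promote-stub` (file as TWO items; the weighted static one first).
Sources: doi:10.1090/surv/127 Ch. 5/7; doi:10.1007/s00023-008-0389-1; doi:10.1007/s00023-002-8624-7; ChernovDolgopyat2009; CIP1994;
Villani2002; KipnisLandim1999 A1.8 (entropy inequality). -/
theorem stub_mceW : MesoForecastChaosB ∧ MesoStaticMaxwellRarityW := by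
  sorry

/-- **Stub S3 — local uniform integrability of kinetic collision counts and a packing cap under `LG`** (`LocalCountUI`; item-class tail
input, size L; to be filed as an item per TRIAGE-r2-1 sharpen 3 / r2-2 sharpen c; audited clean by lead a2's wave-1). Why plausibly true:
equilibrium mean by stationarity + super-extensive `G_N`-pricing of window-averaged count levels (Disproof F20) + the entropy inequality for (i);
the landed density domination `LG ≤ Λ^{N+1} G_{θ₁}` (p96578) for (ii). Why it might fail: caged rattlers / implosion pockets at positive times
(DensityCap 13082, F10 e). Sources: KipnisLandim1999 A1.8.2; GST2013 Ch. 4; Spohn1991 Part I Ch. 3. -/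
theorem stub_localCountUI : LocalCountUI := by
  sorry

/-- **Stub S4 — no mesoscopic oscillation between the kinetic cell and the `r`-ball** (`NoMesoscopicOscillationR` = conjunct (i) of the v2
statement verbatim; item-class, crux-adjacent — the residual every line on this crux shares, in the weakened form `[cℓ_N, r]` and typed against
the target's `Pm`; to be filed as an item). Why plausibly true: trivially true whenever the one-body empirical measure path converges to a limit
with an `L²` space-time density that is a slowly varying local Maxwellian (classical Euler before shocks; shocks cost only space-time measure
`≍ Area·r`, F18 e). Why it might fail: rough/turbulent limit fields (F10 b), a two-stream shear pattern at scales `cℓ ≪ s ≪ r` — then the TARGET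
itself is in doubt (route kill criterion (iv)). Sources: Spohn1991 §2.3; BrezinaFeireisl2018; arXiv:1504.03215; Disproof §12. -/
theorem stub_noMesoscopicOscillationR : NoMesoscopicOscillationR := by
  sorry

/-- **Stub S4b (v9) — no kinetic irregularity of occupied / void-adjacent cells under `LG`, BINNED velocities** (`NoKineticIrregularityB`;
item-class LG-side regularity input, `LocalCountUI`-adjacent; to be filed). Content: the `LG`-expected unit-fraction of actual kinetic cells
with a populated `4cℓ`-neighbourhood that are `ϑ`-inhomogeneous (smoothed laws of bin-centre velocities of cell vs neighbourhood; kinetic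
VOIDS count, `inhom = 1`) or occupied by fewer than `m₀` spheres (kinetic RAREFACTION) is small for `c ≥ c₀(ϑs, ϑ, δ, m₀)`, `b ≤ b₀(c)`.
Same class and content as v5's `NoKineticIrregularity` (an `O(b/ϑs)` perturbation of `inhom`; red team W5 transfers). Why it might fail:
vacuum formation / implosion pockets; a cell-scale two-stream structure (then S4 fails too). -/
theorem stub_noKineticIrregularityB : NoKineticIrregularityB := by
  sorry

/-- **Stub S8a — rough owned collisions are rare under `LG`** (`RoughCollisionRare`, v6; the MINIMAL LG-side input behind
`RevealedDefectStability`, typed by worker W6's audit, `…RevealedDefectReduction.lean` p143339; item-class, `LocalCountUI`-adjacent, to be FILED).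
Content: for `c ≥ c₀` there are thresholds `(g, V, s₀, E₀)` (grazing, fast, cold, hot — chosen AFTER `c`) such that the `LG`-expected unit average
of `min(roughOwnedCount g V s₀ E₀, T)` — owned ordered contact pairs that are `g`-grazing, or have a participant faster than `V`, or whose
start-cell populations are not tame — is `≤ δ` for large `N`. Why plausibly true: grazing flux share `≍ g²/(4θ)`, Maxwell tails, cold/hot
populations of `≍ n̄` spheres cost `e^{-n̄ I}`; at positive times it is propagation of "no grazing concentration, no kinetic-scale temperature
collapse / energy concentration" (the fast channel is `CollisionMomentBound` 15144-class). Why it might fail: aligned streams (grazing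
concentration) or cold/hot pockets at positive times. -/
theorem stub_roughCollisionRare : RoughCollisionRare := by
  sorry

/-- **Stub S8b — the collision half of the revealed-atom dictionary** (`AtomCollisionDictionary`; DETERMINISTIC enumeration; CLOSED by
worker W8, `…AtomCollisionDictionary.lean` p149815: two good initial data with the same data revealed right after unit `(k, q)` have
label-preserving corresponding `q`-owned collision triples of step `k` with `2b`-close pre-collisional velocities and `4b`-close kicks — equal
record lists of the member starting in `q`, index correspondence through `nthRecordOf`). -/
theorem stub_atomCollisionDictionary : AtomCollisionDictionary :=
  Summit.AtomisticToContinuum.HydrodynamicLimit.Theorems.EquilibriumForecastLine.stub_atomCollisionDictionary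

/-- **Stub S8 — revealed-defect stability** (`RevealedDefectStability`; v2 statement, audited CLEAN and ITEM-CLASS by worker W6; CLOSED modulo
the item S8a by W6's reduction `revealedDefectStability_of_atomCollisionDictionary` (`…RevealedDefectAssembly` p146207: oscillation lemma
`DefectOscDomination` from the dictionary, `…RevealedDefectDictionaryBound` p146005, flux / pair-law stability `…RevealedDefectFluxStability`
p144032, `…RevealedDefectPairLaw` p144766, facts `…RevealedDefectFacts` p142789). -/
theorem stub_revealedDefectStability : RevealedDefectStability :=
  revealedDefectStability_of_atomCollisionDictionary stub_roughCollisionRare stub_atomCollisionDictionary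

/-- **Stub S5 (v9) — COLLISION-WEIGHTED local equilibrium at the kinetic-cell scale, static Cesàro assembly**
(`MesoStaticMaxwellRarityW → LocalCountUI → NoKineticIrregularityB → CoarseLocalMaxwellianityW`; CLOSED by lead c4's worker W4,
`…CesaroLocalEquilibriumW` p155628). Proof
(the v5 proof `stub_cesaroLocalEquilibrium` p144149 / `lintegral_nonMaxwellian_floor_le` p142485 with weights `≤ T`): pointwise per unit
`𝟙{occupied ∧ ϑ < relEnt_b}·min(oc, T) ≤ 𝟙{Regular_b ∧ m₀ ≤ #pop ∧ ϑ ≤ relEnt_b}·min(oc, T) + T·𝟙{occupied ∧ Dense} + T·𝟙{occupied ∧ ϑh < inhom_b}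
+ T·𝟙{occupied ∧ #pop < m₀}`; the first term's `LG`-mean is `≤ δ' + 27 T (log 2 + A)/L` by `MesoStaticMaxwellRarityW` and `exists_lgTransferConst`
(last conjunct, `M = 27 T`), the second `≤ T δ₁` by `LocalCountUI` (ii), the last two `≤ T δ₂` by `NoKineticIrregularityB` (an occupied cell is
an actual cell with a populated neighbourhood, `actual_and_nbhd_of_pop_nonempty`); choose `δ' = δ/4`, `L = 108 T (log 2 + A)/δ`, `δ₁ = δ₂ =
δ/(4T)`, `c₀ = max`, `b₀ = min`, `N₀ = max` (+ `cℓ_N ≤ 1`). -/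
theorem stub_cesaroW :
    MesoStaticMaxwellRarityW → LocalCountUI → NoKineticIrregularityB → CoarseLocalMaxwellianityW :=
  Summit.AtomisticToContinuum.HydrodynamicLimit.Theorems.EquilibriumForecastLine.stub_cesaroW

/-- **Stub S6 (v9) — the WEIGHTED forecast transfer** (`MesoForecastChaosB → LocalCountUI → NoKineticIrregularityB → CoarseLocalMaxwellianityW →
RevealedDefectStability → KineticCellChaosLG`; CLOSED by lead c4, `…ForecastTransferW` p157027). Proof = the weighted architecture `kineticCellChaosLG_of_w : ForecastSwap →
BadForecastRareB → NonGoodRareW → RevealedSandwich → ForecastAlgebra → ForecastSplitW → KineticCellChaosLG` (lead, `…ForecastTransferArchW`: the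
chain in the module docstring of `…ForecastRobustDefs`) with H1 `forecastSwap_holds` (p141614), H2_B `badForecastRareB_of : MesoForecastChaosB →
BadForecastRareB` (worker; v5 proof p143786 verbatim with the binned guard), H3_W `nonGoodRareW_of : JngSpec → CoarseLocalMaxwellianityW →
LocalCountUI → NoKineticIrregularityB → NonGoodRareW` (worker), H4 `revealedSandwich_of` (p144080), H5 `forecastAlgebra_holds` (p144106), H5_W
`forecastSplitW_of : JngSpec → ForecastSplitW` (worker: pull-in of the revealed indicator, pointwise split), and the dictionary fact
`jngSpec_holds : JngSpec` (worker). The v5 transfer `stub_forecastTransfer` (p147963) stays a tree theorem over the v5 statements. -/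
theorem stub_forecastTransferW :
    MesoForecastChaosB → LocalCountUI → NoKineticIrregularityB → CoarseLocalMaxwellianityW → RevealedDefectStability →
      KineticCellChaosLG :=
  Summit.AtomisticToContinuum.HydrodynamicLimit.Theorems.EquilibriumForecastLine.stub_forecastTransferW

/-- **Stub S7 — the kinetic docking** (`KineticCellChaosLG → NoMesoscopicOscillationR → LocalCountUI → ContactChaos`; CLOSED:
`Theorems.EquilibriumForecastLine.stub_dockingR`, `…DockingR.lean` — the assembly `docking_of_aemeasurable_R` (Markov on KCC / UI (i) through
the a.e.-measurability p135792, NMO (i) in probability, LG energy tail via `exists_localGibbsLaw_dominated`, contact-null start, union bound,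
`measure_contactDefect_le`) ∘ the deterministic good-orbit bound `abs_dockDefect_le` (p135004; F1 p134344, budget p130417/p134451, tail p134640,
pieces A–E p126653/p126738/p126831/p128456/p128771/p129489)). -/
theorem stub_dockingR :
    KineticCellChaosLG → NoMesoscopicOscillationR → LocalCountUI →
      Summit.AtomisticToContinuum.HydrodynamicLimit.Theses.InformationPercolationEngine.ContactChaos :=
  Summit.AtomisticToContinuum.HydrodynamicLimit.Theorems.EquilibriumForecastLine.stub_dockingR

/-! ## §7 Composition (sorry-free) -/

/-- The chain-rule line reaches the route TARGET: S2–S5, S4b, S8 feed the transfer S6, whose output docks through S7 with S4 and S3. -/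
theorem contactChaos_of_stubs :
    Summit.AtomisticToContinuum.HydrodynamicLimit.Theses.InformationPercolationEngine.ContactChaos :=
  stub_dockingR
    (stub_forecastTransferW stub_mceW.1 stub_localCountUI stub_noKineticIrregularityB
      (stub_cesaroW stub_mceW.2 stub_localCountUI stub_noKineticIrregularityB) stub_revealedDefectStability)
    stub_noMesoscopicOscillationR stub_localCountUI

/-- **Composition.** The stubs imply the crux `InformationPercolationEngine.PercolationClosesChaos`, concluded BY NAME (kernel-checked; the
only `sorry`s are inside the stubs it invokes). The crux's two hypotheses are deliberately NOT used (Disproof §1 `crux_of_contactChaos`, F16: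
`SpectralContractionR` is PROVED and formally decorative; `KickFairRelEquilibriumMeso` — the LG-vs-G fairness of kicks given a NON-nested
two-snapshot past — is replaced by the nested-filtration chain rule, which is a theorem, and by `MesoForecastChaos` on the `G_N` side). -/
theorem PercolationClosesChaos_of :
    Summit.AtomisticToContinuum.HydrodynamicLimit.Theses.InformationPercolationEngine.PercolationClosesChaos :=
  fun _ _ => contactChaos_of_stubs

/-- **The same composition through the LANDED tree theorem** `percolationClosesChaos_of_inputs` (`…OfInputs.lean`, p158913, lead c5):
the crux is the six inputs and nothing else. -/
theorem PercolationClosesChaos_of' :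
    Summit.AtomisticToContinuum.HydrodynamicLimit.Theses.InformationPercolationEngine.PercolationClosesChaos :=
  percolationClosesChaos_of_inputs stub_mceW.1 stub_mceW.2 stub_localCountUI stub_noKineticIrregularityB
    stub_noMesoscopicOscillationR stub_roughCollisionRare

end Summit.AtomisticToContinuum.HydrodynamicLimit.Cruxes.PercolationClosesChaos.EquilibriumForecastChainRule

end
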